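import Summits.Ventures.HodgeRepro.Tier4.Common.UnitaryHyperbolic

/-!
# Tier4/Common/UnitaryHyperbolicCayley — the Cayley homomorphism `Circle × SL(2, ℝ) →* U(J)`: continuous and surjective

Blind re-derivation cell `pub-hodge-repro`, Tier 4 (README §9–§10), seat t4-typer-2 (gen 5).  Target tree path
`lean/Summits/Ventures/HodgeRepro/Tier4/Common/UnitaryHyperbolicCayley.lean`; imports Mathlib + `Common.UnitaryHyperbolic`.
STAGE C1 of C-COMMON-SL2BALL (offer S15543, taken S15558), module 2/3, for `J = diag (α, β)` with `α > 0 > β`: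
* `U(J) = D · U(J₀) · D⁻¹` with `D = diag (√α, √(-β))` (`Dmat_mul_J₀_mul_Dmat : D J₀ D = J`, `Dinv_mul_Jmat_mul_Dinv`);
* `cayMat (z, h) = z • (D * cay₀ h * D⁻¹)`: multiplicative, `cayMat 1 = 1`, lands in `U(J)` (`cayMat_mem`);
  **`cayley hα hβ : Circle × SL(2, ℝ) →* ↥(UJ α β)`** (`coe_cayley : ↑↑(cayley x) = cayMat x`), CONTINUOUS
  (`continuous_cayley`, through `Units.continuous_iff`);
* **`cayley_surjective`**: for `m ∈ U(J)`, `n = D⁻¹ m D ∈ U(J₀)` has `|det n| = 1`; a square root `z` of `det n`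
  (`IsAlgClosed.exists_pow_nat_eq`) has `|z| = 1`; `u = z⁻¹ • n ∈ SU(1, 1)` has the shape `!![a, b; conj b, conj a]`
  (`shape_of_su11`: `J₀ uᴴ J₀ = u⁻¹ = adjugate u`) with `|a|² − |b|² = 1`, and the INVERSE CAYLEY transform
  `cayInv a b = !![re a + re b, im a − im b; −im a − im b, re a − re b] ∈ SL(2, ℝ)` satisfies `cay₀ (cayInv a b) = u`
  (`cay₀_cayInv`); so `m = cayMat (z, cayInv a b)`.
Module 3/3 (`UnitaryHyperbolicGrowth`): properness, the norm comparison and the ball growth of `U(J)`.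

Nothing here says anything about the status of the Hodge conjecture for CM abelian varieties, which is NOT proved
(HC_CM is NOT proved by anyone in this repository).
-/

set_option autoImplicit false

noncomputable section

open Matrix Topology
open scoped MatrixGroups ComplexConjugate

namespace Summit.Ventures.HodgeRepro.Tier4.Common

namespace SL2Ball

/-! ## 4. The general form: `U(J) = D · U(J₀) · D⁻¹` with `D = diag (√α, √(-β))`, and the Cayley homomorphism -/

section General

variable (α β : ℝ)

/-- `D = diag (√α, √(-β))`. -/
def Dmat : Matrix (Fin 2) (Fin 2) ℂ := diagonal ![((Real.sqrt α : ℝ) : ℂ), ((Real.sqrt (-β) : ℝ) : ℂ)]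

/-- `D⁻¹ = diag ((√α)⁻¹, (√(-β))⁻¹)`. -/
def Dinv : Matrix (Fin 2) (Fin 2) ℂ := diagonal ![(((Real.sqrt α)⁻¹ : ℝ) : ℂ), (((Real.sqrt (-β))⁻¹ : ℝ) : ℂ)]

variable {α β}

/-- `D⁻¹ * D = 1`. -/
theorem Dinv_mul_Dmat (hα : 0 < α) (hβ : β < 0) : Dinv α β * Dmat α β = 1 := by
  have h1 : Real.sqrt α ≠ 0 := (Real.sqrt_pos.2 hα).ne'
  have h2 : Real.sqrt (-β) ≠ 0 := (Real.sqrt_pos.2 (by linarith)).ne'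
  ext i j
  fin_cases i <;> fin_cases j <;> simp [Dinv, Dmat, Matrix.mul_apply, Fin.sum_univ_two, h1, h2]

/-- `D * D⁻¹ = 1`. -/
theorem Dmat_mul_Dinv (hα : 0 < α) (hβ : β < 0) : Dmat α β * Dinv α β = 1 := by
  have h1 : Real.sqrt α ≠ 0 := (Real.sqrt_pos.2 hα).ne'
  have h2 : Real.sqrt (-β) ≠ 0 := (Real.sqrt_pos.2 (by linarith)).ne'
  ext i j
  fin_cases i <;> fin_cases j <;> simp [Dinv, Dmat, Matrix.mul_apply, Fin.sum_univ_two, h1, h2]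

/-- `D` is hermitian (real diagonal). -/
theorem Dmat_conjTranspose : (Dmat α β)ᴴ = Dmat α β := by
  ext i j
  fin_cases i <;> fin_cases j <;> simp [Dmat]

/-- `D⁻¹` is hermitian (real diagonal). -/
theorem Dinv_conjTranspose : (Dinv α β)ᴴ = Dinv α β := by
  ext i j
  fin_cases i <;> fin_cases j <;> simp [Dinv]

/-- `D * J₀ * D = J`. -/
theorem Dmat_mul_J₀_mul_Dmat (hα : 0 < α) (hβ : β < 0) : Dmat α β * J₀ * Dmat α β = Jmat α β := by
  have h1 : Real.sqrt α * Real.sqrt α = α := Real.mul_self_sqrt hα.le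
  have h2 : Real.sqrt (-β) * Real.sqrt (-β) = -β := Real.mul_self_sqrt (by linarith)
  ext i j
  fin_cases i <;> fin_cases j <;>
    simp [Dmat, J₀, Jmat, Matrix.mul_apply, Fin.sum_univ_two, Complex.ext_iff] <;> nlinarith [h1, h2]

/-- `D⁻¹ * J * D⁻¹ = J₀`. -/
theorem Dinv_mul_Jmat_mul_Dinv (hα : 0 < α) (hβ : β < 0) : Dinv α β * Jmat α β * Dinv α β = J₀ := by
  have h1 : Real.sqrt α * Real.sqrt α = α := Real.mul_self_sqrt hα.le
  have h2 : Real.sqrt (-β) * Real.sqrt (-β) = -β := Real.mul_self_sqrt (by linarith)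
  have h1' : Real.sqrt α ≠ 0 := (Real.sqrt_pos.2 hα).ne'
  have h2' : Real.sqrt (-β) ≠ 0 := (Real.sqrt_pos.2 (by linarith)).ne'
  ext i j
  fin_cases i <;> fin_cases j <;>
    simp [Dinv, J₀, Jmat, Matrix.mul_apply, Fin.sum_univ_two, Complex.ext_iff] <;> field_simp <;> nlinarith [h1, h2]

variable (α β)

/-- The matrix of the Cayley homomorphism: `(z, h) ↦ z • (D * cay₀ h * D⁻¹)`. -/
def cayMat (x : Circle × SL(2, ℝ)) : Matrix (Fin 2) (Fin 2) ℂ := (x.1 : ℂ) • (Dmat α β * cay₀ x.2 * Dinv α β)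

variable {α β}

/-- `cayMat` is multiplicative. -/
theorem cayMat_mul (hα : 0 < α) (hβ : β < 0) (x y : Circle × SL(2, ℝ)) :
    cayMat α β (x * y) = cayMat α β x * cayMat α β y := by
  have hM : Dmat α β * cay₀ (x * y).2 * Dinv α β =
      (Dmat α β * cay₀ x.2 * Dinv α β) * (Dmat α β * cay₀ y.2 * Dinv α β) := by
    rw [Prod.snd_mul, cay₀_mul]
    calc Dmat α β * (cay₀ x.2 * cay₀ y.2) * Dinv α β
        = Dmat α β * cay₀ x.2 * (Dinv α β * Dmat α β) * cay₀ y.2 * Dinv α β := by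
          rw [Dinv_mul_Dmat hα hβ, Matrix.mul_one]
          simp only [Matrix.mul_assoc]
      _ = _ := by simp only [Matrix.mul_assoc]
  simp only [cayMat, hM, Prod.fst_mul, Circle.coe_mul, Matrix.smul_mul, Matrix.mul_smul, smul_smul]
  rw [mul_comm (x.1 : ℂ) (y.1 : ℂ)]

/-- `cayMat 1 = 1`. -/
theorem cayMat_one (hα : 0 < α) (hβ : β < 0) : cayMat α β 1 = 1 := by
  simp only [cayMat, Prod.fst_one, Prod.snd_one, Circle.coe_one, cay₀_one, Matrix.mul_one, Dmat_mul_Dinv hα hβ,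
    one_smul]

/-- `cayMat x` lies in `U(J)`. -/
theorem cayMat_mem (hα : 0 < α) (hβ : β < 0) (x : Circle × SL(2, ℝ)) :
    cayMat α β x * Jmat α β * (cayMat α β x)ᴴ = Jmat α β := by
  have hz : star (x.1 : ℂ) * (x.1 : ℂ) = 1 := by
    rw [Complex.star_def, mul_comm, Complex.mul_conj, Circle.normSq_coe, Complex.ofReal_one]
  simp only [cayMat, Matrix.conjTranspose_smul, Matrix.smul_mul, Matrix.mul_smul, smul_smul,
    Matrix.conjTranspose_mul, Dinv_conjTranspose, Dmat_conjTranspose]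
  rw [hz, one_smul]
  calc Dmat α β * cay₀ x.2 * Dinv α β * Jmat α β * (Dinv α β * ((cay₀ x.2)ᴴ * Dmat α β))
      = Dmat α β * (cay₀ x.2 * (Dinv α β * Jmat α β * Dinv α β) * (cay₀ x.2)ᴴ) * Dmat α β := by
        simp only [Matrix.mul_assoc]
    _ = Jmat α β := by rw [Dinv_mul_Jmat_mul_Dinv hα hβ, cay₀_mem_su11, Dmat_mul_J₀_mul_Dmat hα hβ]

/-- The Cayley map as an element of `GL (Fin 2) ℂ`. -/
def cayGL (hα : 0 < α) (hβ : β < 0) (x : Circle × SL(2, ℝ)) : GL (Fin 2) ℂ :=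
  ⟨cayMat α β x, cayMat α β x⁻¹, by rw [← cayMat_mul hα hβ, mul_inv_cancel, cayMat_one hα hβ],
    by rw [← cayMat_mul hα hβ, inv_mul_cancel, cayMat_one hα hβ]⟩

/-- The matrix of `cayGL`. -/
@[simp] theorem coe_cayGL (hα : 0 < α) (hβ : β < 0) (x : Circle × SL(2, ℝ)) :
    (cayGL hα hβ x : Matrix (Fin 2) (Fin 2) ℂ) = cayMat α β x := rfl

/-- The matrix of `(cayGL x)⁻¹`. -/
@[simp] theorem coe_cayGL_inv (hα : 0 < α) (hβ : β < 0) (x : Circle × SL(2, ℝ)) :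
    ((cayGL hα hβ x)⁻¹ : GL (Fin 2) ℂ) = (cayMat α β x⁻¹ : Matrix (Fin 2) (Fin 2) ℂ) := rfl

/-- **The Cayley homomorphism** `Circle × SL(2, ℝ) →* U(J)`, `(z, h) ↦ z • (D * (C₀ h C₀⁻¹) * D⁻¹)`. -/
def cayley (hα : 0 < α) (hβ : β < 0) : Circle × SL(2, ℝ) →* ↥(UJ α β) where
  toFun x := ⟨cayGL hα hβ x, cayMat_mem hα hβ x⟩
  map_one' := Subtype.ext (Units.ext (by simp [cayMat_one hα hβ]))
  map_mul' x y := Subtype.ext (Units.ext (by simp [cayMat_mul hα hβ]))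

/-- The matrix of `cayley x`. -/
@[simp] theorem coe_cayley (hα : 0 < α) (hβ : β < 0) (x : Circle × SL(2, ℝ)) :
    (((cayley hα hβ x : ↥(UJ α β)) : GL (Fin 2) ℂ) : Matrix (Fin 2) (Fin 2) ℂ) = cayMat α β x := rfl

/-- `cayMat` is continuous. -/
theorem continuous_cayMat : Continuous (cayMat α β) := by
  have h1 : Continuous fun x : Circle × SL(2, ℝ) => (x.1 : ℂ) := continuous_subtype_val.comp continuous_fst
  have h2 : Continuous fun x : Circle × SL(2, ℝ) => toC (x.2 : Matrix (Fin 2) (Fin 2) ℝ) := by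
    have : Continuous fun x : Circle × SL(2, ℝ) => (x.2 : Matrix (Fin 2) (Fin 2) ℝ) :=
      continuous_subtype_val.comp continuous_snd
    exact this.matrix_map Complex.continuous_ofReal
  have h3 : Continuous fun x : Circle × SL(2, ℝ) => cay₀ x.2 :=
    (continuous_const.matrix_mul h2).matrix_mul continuous_const
  exact h1.smul ((continuous_const.matrix_mul h3).matrix_mul continuous_const)

/-- `cayley` is continuous (into the Units topology of `GL (Fin 2) ℂ`, restricted to `U(J)`). -/
theorem continuous_cayley (hα : 0 < α) (hβ : β < 0) : Continuous (cayley hα hβ) := by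
  refine continuous_induced_rng.2 ?_
  refine Units.continuous_iff.2 ⟨?_, ?_⟩
  · exact continuous_cayMat
  · exact continuous_cayMat.comp continuous_inv

end General

/-! ## 5. Surjectivity of the Cayley homomorphism -/

section Surjective

/-- `J₀ * J₀ = 1`. -/
theorem J₀_mul_J₀ : J₀ * J₀ = 1 := by
  ext i j
  fin_cases i <;> fin_cases j <;> simp [J₀, Jmat, Matrix.mul_apply, Fin.sum_univ_two]

/-- `det J₀ = -1`. -/
theorem det_J₀ : J₀.det = -1 := by
  simp [J₀, Jmat]

/-- `J₀` is hermitian. -/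
theorem J₀_conjTranspose : J₀ᴴ = J₀ := Jmat_conjTranspose 1 (-1)

/-- A matrix of `SU(1, 1)` has the shape `!![a, b; conj b, conj a]`. -/
theorem shape_of_su11 (u : Matrix (Fin 2) (Fin 2) ℂ) (hu : u * J₀ * uᴴ = J₀) (hdet : u.det = 1) :
    u = !![u 0 0, u 0 1; conj (u 0 1), conj (u 0 0)] := by
  have h1 : u * (J₀ * uᴴ * J₀) = 1 := by
    calc u * (J₀ * uᴴ * J₀) = (u * J₀ * uᴴ) * J₀ := by simp only [Matrix.mul_assoc]
      _ = 1 := by rw [hu, J₀_mul_J₀]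
  have h2 : u * adjugate u = 1 := by rw [Matrix.mul_adjugate, hdet, one_smul]
  have h3 : J₀ * uᴴ * J₀ = adjugate u := by
    rw [← Matrix.inv_eq_right_inv h1, ← Matrix.inv_eq_right_inv h2]
  rw [Matrix.adjugate_fin_two] at h3
  have e00 := congrFun (congrFun h3 0) 0
  have e01 := congrFun (congrFun h3 0) 1
  simp [J₀, Jmat, Matrix.mul_apply, Fin.sum_univ_two, Matrix.conjTranspose_apply] at e00 e01
  ext i j
  fin_cases i <;> fin_cases j
  · simp
  · simp
  · show u 1 0 = conj (u 0 1)
    rw [← e01, Complex.conj_conj]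
  · show u 1 1 = conj (u 0 0)
    exact e00.symm

/-- `det !![a, b; conj b, conj a] = |a|² - |b|²` (as a complex number). -/
theorem det_shape (a b : ℂ) : (!![a, b; conj b, conj a]).det = ((Complex.normSq a - Complex.normSq b : ℝ) : ℂ) := by
  rw [Matrix.det_fin_two_of]
  push_cast
  rw [← Complex.mul_conj, ← Complex.mul_conj]

/-- The inverse Cayley transform of `!![a, b; conj b, conj a]` with `|a|² - |b|² = 1`: the real matrix
`!![re a + re b, im a - im b; -im a - im b, re a - re b]` of determinant `1`. -/
def cayInv (a b : ℂ) (hab : Complex.normSq a - Complex.normSq b = 1) : SL(2, ℝ) :=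
  ⟨!![a.re + b.re, a.im - b.im; -a.im - b.im, a.re - b.re], by
    rw [Matrix.det_fin_two_of]
    simp only [Complex.normSq_apply] at hab
    linear_combination hab⟩

/-- `cayA (cayInv a b) = a`. -/
theorem cayA_cayInv (a b : ℂ) (hab : Complex.normSq a - Complex.normSq b = 1) : cayA (cayInv a b hab) = a := by
  apply Complex.ext <;> simp [cayA, cayInv]

/-- `cayB (cayInv a b) = b`. -/
theorem cayB_cayInv (a b : ℂ) (hab : Complex.normSq a - Complex.normSq b = 1) : cayB (cayInv a b hab) = b := by
  refine Complex.ext ?_ ?_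
  · simp [cayB, cayInv]
  · simp [cayB, cayInv]
    ring

/-- `cay₀ ∘ cayInv` is the identity on the shape `!![a, b; conj b, conj a]`. -/
theorem cay₀_cayInv (a b : ℂ) (hab : Complex.normSq a - Complex.normSq b = 1) :
    cay₀ (cayInv a b hab) = !![a, b; conj b, conj a] := by
  rw [cay₀_eq, cayA_cayInv, cayB_cayInv]

/-- **`SU(1, 1)` is the image of `SL(2, ℝ)` under the Cayley transform.** -/
theorem exists_cay₀_eq (u : Matrix (Fin 2) (Fin 2) ℂ) (hu : u * J₀ * uᴴ = J₀) (hdet : u.det = 1) :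
    ∃ h : SL(2, ℝ), cay₀ h = u := by
  have hshape := shape_of_su11 u hu hdet
  have hab : Complex.normSq (u 0 0) - Complex.normSq (u 0 1) = 1 := by
    have := det_shape (u 0 0) (u 0 1)
    rw [← hshape, hdet] at this
    exact (Complex.ofReal_eq_one.1 this.symm)
  exact ⟨cayInv (u 0 0) (u 0 1) hab, by rw [cay₀_cayInv, ← hshape]⟩

variable {α β : ℝ}

/-- **`cayley` is surjective**: every element of `U(J)` is `z • (D (C₀ h C₀⁻¹) D⁻¹)` for some `z ∈ U(1)`, `h ∈ SL(2, ℝ)`. -/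
theorem cayley_surjective (hα : 0 < α) (hβ : β < 0) : Function.Surjective (cayley hα hβ) := by
  intro m
  set M : Matrix (Fin 2) (Fin 2) ℂ := ((m : GL (Fin 2) ℂ) : Matrix (Fin 2) (Fin 2) ℂ) with hM
  have hmem : M * Jmat α β * Mᴴ = Jmat α β := m.2
  -- the conjugate `n = D⁻¹ M D` lies in `U(J₀)`
  set n : Matrix (Fin 2) (Fin 2) ℂ := Dinv α β * M * Dmat α β with hn
  have hn₀ : n * J₀ * nᴴ = J₀ := by
    calc n * J₀ * nᴴ = Dinv α β * (M * (Dmat α β * J₀ * Dmat α β) * Mᴴ) * Dinv α β := by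
          simp only [hn, Matrix.conjTranspose_mul, Dmat_conjTranspose, Dinv_conjTranspose, Matrix.mul_assoc]
      _ = J₀ := by rw [Dmat_mul_J₀_mul_Dmat hα hβ, hmem, Dinv_mul_Jmat_mul_Dinv hα hβ]
  -- `|det n| = 1`
  have hdetn : Complex.normSq n.det = 1 := by
    have h := congrArg Matrix.det hn₀
    rw [Matrix.det_mul, Matrix.det_mul, Matrix.det_conjTranspose, det_J₀] at h
    have h' : n.det * star n.det = 1 := by
      have : n.det * -1 * star n.det = -1 := h
      linear_combination -this
    rw [Complex.star_def, Complex.mul_conj] at h'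
    exact Complex.ofReal_eq_one.1 h'
  -- a square root `z` of `det n`, of modulus one
  obtain ⟨z, hz⟩ := IsAlgClosed.exists_pow_nat_eq n.det (by norm_num : 0 < 2)
  have hz1 : Complex.normSq z = 1 := by
    have h2 : Complex.normSq z ^ 2 = 1 := by rw [← map_pow, hz, hdetn]
    nlinarith [Complex.normSq_nonneg z]
  have hz0 : z ≠ 0 := by
    intro h0
    rw [h0, map_zero] at hz1
    exact zero_ne_one hz1
  have hznorm : ‖z‖ = 1 := by
    have := Complex.normSq_eq_norm_sq z
    rw [hz1] at this
    nlinarith [norm_nonneg z]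
  let zc : Circle := ⟨z, mem_sphere_zero_iff_norm.2 hznorm⟩
  -- `u = z⁻¹ • n ∈ SU(1, 1)`
  set u : Matrix (Fin 2) (Fin 2) ℂ := z⁻¹ • n with hu
  have hu₀ : u * J₀ * uᴴ = J₀ := by
    have hzz : star z⁻¹ * z⁻¹ = 1 := by
      rw [Complex.star_def, mul_comm, Complex.mul_conj, map_inv₀, hz1, inv_one, Complex.ofReal_one]
    simp only [hu, Matrix.conjTranspose_smul, Matrix.smul_mul, Matrix.mul_smul, smul_smul, hzz, one_smul, hn₀]
  have hudet : u.det = 1 := by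
    rw [hu, Matrix.det_smul, Fintype.card_fin, ← hz, inv_pow, inv_mul_cancel₀ (pow_ne_zero 2 hz0)]
  obtain ⟨h, hh⟩ := exists_cay₀_eq u hu₀ hudet
  refine ⟨(zc, h), ?_⟩
  apply Subtype.ext
  apply Units.ext
  rw [coe_cayley]
  show (z : ℂ) • (Dmat α β * cay₀ h * Dinv α β) = M
  rw [hh, hu, Matrix.mul_smul, Matrix.smul_mul, smul_smul, mul_inv_cancel₀ hz0, one_smul, hn]
  calc Dmat α β * (Dinv α β * M * Dmat α β) * Dinv α β
      = (Dmat α β * Dinv α β) * M * (Dmat α β * Dinv α β) := by simp only [Matrix.mul_assoc]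
    _ = M := by rw [Dmat_mul_Dinv hα hβ, Matrix.one_mul, Matrix.mul_one]

end Surjective

end SL2Ball

end Summit.Ventures.HodgeRepro.Tier4.Common
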